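import Mathlib.Data.Nat.ChineseRemainder
import Mathlib.NumberTheory.Primorial
import Mathlib.Analysis.SpecialFunctions.Pow.Real
import Mathlib.Analysis.Calculus.ContDiff.Basic
import Literature.NumberTheory.Sieve.MaynardTao
import Literature.NumberTheory.Sieve.LevelOfDistributionProofs
import HarnessLib

/-!
# Maynard's sieve sums `S₁`, `S₂^{(m)}` (Prop. 4.1 as named facts) and the deduction of Prop. 4.2

Topic `Literature/NumberTheory/Sieve`; companion of `MaynardTao.lean` (J. Maynard, *Small gaps between
primes*, Ann. of Math. (2) 181 (2015), 383–413 = arXiv:1311.4600; page numbers below refer to the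
arXiv text). `MaynardTao.lean` vendors Maynard's Prop. 4.2 (with the conclusion of Thm 3.1) as ONE
named fact `Literature.NumberTheory.Sieve.frequently_card_primes_ge_of_maynardFunctional`, in the square-integrable generality
of Polymath 8b. This file opens that box along the printed proof:

* §4 objects (p. 7): `D₀ = log log log N` (`maynardD0`), `W = ∏_{p ≤ D₀} p` (`maynardW`),
  `R = N^{θ/2−δ}` (`maynardR`), the weights `λ_{d₁,…,d_k}` of Prop. 4.1 (`maynardWeight`, already in
  `MaynardTao.lean`), the divisor sums `∑_{dᵢ ∣ n+hᵢ ∀ i} λ_d` (`maynardDivisorSum`), and the sums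
  `S₁`, `S₂^{(m)}` over `N ≤ n < 2N`, `n ≡ v₀ (mod W)` (`maynardS1`, `maynardS2`); the common size
  `φ(W)^k N (log R)^k / W^{k+1}` of the main terms (`maynardMainTerm`); and Maynard's own level
  hypothesis, §1 p. 3: `∑_{q ≤ x^θ} max_{(a,q)=1} |π(x; q, a) − π(x)/φ(q)| ≪_A x/(log x)^A`
  (`MaynardPrimesHaveLevel`), which follows at every `θ₁ < θ` from the tree's `PrimesHaveLevel θ`
  (`maynardPrimesHaveLevel_of_primesHaveLevel`, via `PrimesHaveLevel.primesHaveLevelPi` of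
  `LevelOfDistributionProofs.lean`).
* **Prop. 4.1 as two named facts** (the deep sieve input, Maynard §§5–6: Lemmas 5.1–5.3, the
  partial-summation Lemma 6.1 quoted from Goldston–Graham–Pintz–Yıldırım, and Lemmas 6.2, 6.3):
  `maynard_S1_asymptotic` (Lemma 6.2: `S₁ = 𝔐 (I_k(F) + o(1))`) and `maynard_S2_asymptotic`
  (Lemma 6.3: `S₂^{(m)} = 𝔐 ((log R/log N) J_k^{(m)}(F) + o(1))`), `𝔐 = φ(W)^k N (log R)^k/W^{k+1}`,
  for test functions `F = G · 1_{R_k}` with `G ∈ C¹(ℝ^k)` — Maynard's "fixed piecewise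
  differentiable function `F` supported on `R_k`", the class containing the polynomials cut off to
  `R_k` that §7 feeds into Prop. 4.1 — and for ANY residues `v₀ = v₀(N)` with `(v₀ + hᵢ, W) = 1`.
  The printed error terms `O(F_max² 𝔐/D₀)` are vendored in the weaker form `o(𝔐)` (`D₀ → ∞`).
* **Prop. 4.2 deduced from them, PROVED** (`frequently_card_primes_ge_of_maynardFunctional_smooth_of_asymptotics`):
  the positivity argument of §2 (p. 5: `S(N, ρ) = ∑_n (∑ᵢ χ_ℙ(n+hᵢ) − ρ) w_n > 0` forces some
  `n ∈ [N, 2N)` with more than `ρ` primes among the `n + hᵢ`; `exists_card_ge_of_sum_pos`), the choice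
  of `v₀` by the Chinese remainder theorem (§4, p. 7; `exists_forall_gcd_add_primorial_eq_one`), and
  the computation of the proof of Prop. 4.2 (p. 7):
  `S = 𝔐 ((θ₁/2 − δ) ∑ₘ J^{(m)} − m I + o(1)) > 0` for large `N`, once `θ₁ < θ` and `δ > 0` are
  taken close enough to `θ` and `0`, which the strict hypothesis `∑ₘ J^{(m)}/I > 2m/θ` permits.
  The target of the deduction, `frequently_card_primes_ge_of_maynardFunctional_smooth`, is the
  `C¹`-test-function case of the `MaynardTao` fact (`…_smooth_of_general`), which is all that the
  proofs of Theorems 1.3/1.4 consume (their `F` are polynomials on `R_k`, `MaynardSmallK.lean`).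

Design notes. `n + hᵢ` is formed in `ℤ` (`hᵢ ∈ ℤ` may be negative) and "prime" means a positive
rational prime, as in `frequently_card_primes_ge_of_maynardFunctional`. The divisor variables are
truncated to `1 ≤ dᵢ ≤ ⌊R⌋`, which loses nothing since `λ_d = 0` when some `dᵢ > R`. Shifts are a
function `h : Fin k → ℤ`, assumed injective (the `hᵢ` are distinct); admissibility is only needed to
produce `v₀`, so the two facts ask for the coprimality of `v₀ + hᵢ` with `W` directly.

## References

* J. Maynard, *Small gaps between primes*, Ann. of Math. (2) 181 (2015), 383–413,
  doi:10.4007/annals.2015.181.1.7, arXiv:1311.4600 [MaynardAnnals2015]: §1 (level of distribution,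
  p. 3), §2 (`S(N, ρ)` and the weights `w_n`, p. 5), §4 (`D₀`, `W`, `v₀`, `S₁`, `S₂`, Props. 4.1, 4.2
  and the proof of Prop. 4.2, p. 7), §5 (`S₂^{(m)}`, Lemmas 5.1–5.3, pp. 9–12), §6 (Lemmas 6.1–6.3,
  pp. 13–14).
* D. A. Goldston, S. W. Graham, J. Pintz, C. Y. Yıldırım, *Small gaps between products of two
  primes*, Proc. Lond. Math. Soc. 98 (2009), 741–774 (the source of Lemma 6.1).
-/

noncomputable section

open MeasureTheory Finset Filter Asymptotics
open scoped BigOperators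

namespace Literature.NumberTheory.Sieve

/-! ### The objects of Maynard 2015 §4: `D₀`, `W`, `R`, the sums `S₁`, `S₂^{(m)}` -/

/-- `D₀ = log log log N` (Maynard 2015 §4, p. 7: "it will suffice to choose `D₀ = log log log N`"),
as a natural number (integer part; `0` for small `N`). [cite: MaynardAnnals2015, §4, choice of D₀ (p. 7)] -/
def maynardD0 (N : ℕ) : ℕ := ⌊Real.log (Real.log (Real.log N))⌋₊

/-- `W = ∏_{p ≤ D₀} p` (Maynard 2015 §4, first paragraph), Mathlib's `primorial D₀`.
[cite: MaynardAnnals2015, §4, first paragraph] -/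
def maynardW (N : ℕ) : ℕ := primorial (maynardD0 N)

/-- `R = N^{θ/2 − δ}` (Maynard 2015, Prop. 4.1: "let `R = N^{θ/2−δ}` for some small fixed `δ > 0`"),
as a real power of `N`. [cite: MaynardAnnals2015, Prop. 4.1] -/
def maynardR (θ δ : ℝ) (N : ℕ) : ℝ := (N : ℝ) ^ (θ / 2 - δ)

/-- The common size `φ(W)^k N (log R)^k / W^{k+1}` of the main terms of Prop. 4.1
(Maynard 2015, Prop. 4.1, Lemmas 6.2, 6.3). [cite: MaynardAnnals2015, Prop. 4.1] -/
def maynardMainTerm (k : ℕ) (θ δ : ℝ) (N : ℕ) : ℝ :=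
  (Nat.totient (maynardW N) : ℝ) ^ k * (N : ℝ) * Real.log (maynardR θ δ N) ^ k /
    (maynardW N : ℝ) ^ (k + 1)

/-- The divisor sum `∑_{d₁,…,d_k : dᵢ ∣ n + hᵢ ∀ i} λ_{d₁,…,d_k}` inside the weight
`w_n = (∑_{dᵢ ∣ n+hᵢ ∀ i} λ_{d₁,…,d_k})²` (Maynard 2015 §2, p. 5, and §4, the displays defining `S₁`,
`S₂`, p. 7), with `λ_d = maynardWeight k F R W d` (Prop. 4.1). The `dᵢ` are restricted to
`1 ≤ dᵢ ≤ ⌊R⌋`, which loses nothing: `λ_d = 0` as soon as some `dᵢ > R` (the inner sum defining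
`λ_d` is then empty). [cite: MaynardAnnals2015, §4, definition of S₁, S₂ (p. 7) and Prop. 4.1] -/
def maynardDivisorSum (k : ℕ) (h : Fin k → ℤ) (F : (Fin k → ℝ) → ℝ) (R : ℝ) (W : ℕ) (n : ℕ) : ℝ :=
  ∑ d ∈ (Fintype.piFinset fun _ : Fin k => Finset.Icc 1 ⌊R⌋₊).filter
      (fun d => ∀ i, ((d i : ℕ) : ℤ) ∣ (n : ℤ) + h i),
    maynardWeight k F R W d

/-- `S₁ = ∑_{N ≤ n < 2N, n ≡ v₀ (mod W)} (∑_{dᵢ ∣ n+hᵢ ∀i} λ_d)²` (Maynard 2015 §4, the display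
defining `S₁` before Prop. 4.1, p. 7). [cite: MaynardAnnals2015, §4, definition of S₁ (p. 7)] -/
def maynardS1 (k : ℕ) (h : Fin k → ℤ) (F : (Fin k → ℝ) → ℝ) (R : ℝ) (W v₀ N : ℕ) : ℝ :=
  ∑ n ∈ (Finset.Ico N (2 * N)).filter (fun n => n ≡ v₀ [MOD W]),
    maynardDivisorSum k h F R W n ^ 2

/-- `S₂^{(m)} = ∑_{N ≤ n < 2N, n ≡ v₀ (mod W)} χ_ℙ(n + h_m) (∑_{dᵢ ∣ n+hᵢ ∀i} λ_d)²`
(Maynard 2015 §5, the display defining `S₂^{(m)}` before Lemma 5.2, p. 10; `S₂ = ∑ₘ S₂^{(m)}` is the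
display defining `S₂` in §4, p. 7). Here `χ_ℙ(n + h_m)` means: `n + h_m` is a positive (rational)
prime. [cite: MaynardAnnals2015, §5, definition of S₂^(m) (p. 10)] -/
def maynardS2 (k : ℕ) (h : Fin k → ℤ) (F : (Fin k → ℝ) → ℝ) (R : ℝ) (W v₀ N : ℕ) (m : Fin k) : ℝ :=
  ∑ n ∈ (Finset.Ico N (2 * N)).filter (fun n => n ≡ v₀ [MOD W]),
    (if 0 < (n : ℤ) + h m ∧ ((n : ℤ) + h m).toNat.Prime then (1 : ℝ) else 0) *
      maynardDivisorSum k h F R W n ^ 2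

/-- Maynard's hypothesis "the primes have level of distribution `θ`" (Maynard 2015 §1, p. 3, the
display defining it): for every `A > 0`,
`∑_{q ≤ x^θ} max_{(a,q)=1} |π(x; q, a) − π(x)/φ(q)| ≪_A x/(log x)^A`.
(Compare the tree's `PrimesHaveLevelPi θ`, which asks this for the levels `x^{θ−ε}`, every
`ε > 0`, with an additional `max_{y ≤ x}`; `MaynardPrimesHaveLevel θ₁` for every `θ₁ < θ` follows,
`maynardPrimesHaveLevel_of_primesHaveLevel`.) [cite: MaynardAnnals2015, §1, definition of level of distribution θ (p. 3)] -/
def MaynardPrimesHaveLevel (θ : ℝ) : Prop :=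
  ∀ A : ℝ, 0 < A →
    (fun x : ℝ => ∑ q ∈ Icc 1 ⌊x ^ θ⌋₊,
        ⨆ a : (ZMod q)ˣ, |(LevelOfDistribution.primeCountingMod q (a : ZMod q).val ⌊x⌋₊ : ℝ) -
          (Nat.primeCounting ⌊x⌋₊ : ℝ) / Nat.totient q|) =O[atTop]
      fun x : ℝ => x / Real.log x ^ A

/-! ### Proposition 4.1 (= Lemmas 6.2 and 6.3) as named facts -/

/-- **Maynard 2015, Prop. 4.1, `S₁` part (= Lemma 6.2).** For `k ≥ 1` distinct shifts
`h₁,…,h_k`, `0 < δ`, `0 < θ/2 − δ`, `θ ≤ 1`, a `C¹` function `G` on `ℝ^k` and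
`F = G · 1_{R_k}` ("a fixed piecewise differentiable function `F` supported on `R_k`"), `λ_d` as in
Prop. 4.1 (`maynardWeight`), `W = ∏_{p ≤ D₀} p`, `D₀ = log log log N`, `R = N^{θ/2−δ}`, and ANY
residues `v₀ = v₀(N)` with `(v₀ + hᵢ, W) = 1` for all `i` (as chosen in §4 by the Chinese remainder
theorem), one has, as `N → ∞`,
`S₁ = φ(W)^k N (log R)^k / W^{k+1} · (I_k(F) + o(1))`
(Lemma 6.2 gives the error `O(F_max² φ(W)^k N (log R)^k/(W^{k+1} D₀))`, and `D₀ → ∞`).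
The level of distribution is not used for `S₁` (only `R² ≤ N^{1−2δ}`, i.e. `θ ≤ 1`, in Lemma 5.1).
A deep input (Maynard §5 Lemma 5.1 and §6 Lemmas 6.1–6.2: Selberg-sieve diagonalisation and
partial summation against `μ²/φ`), vendored as a named fact. [cite: MaynardAnnals2015, Prop. 4.1 and Lemma 6.2] -/
def maynard_S1_asymptotic : Prop :=
  ∀ (k : ℕ), 0 < k → ∀ (h : Fin k → ℤ), Function.Injective h →
  ∀ (θ δ : ℝ), 0 < δ → 0 < θ / 2 - δ → θ ≤ 1 →
  ∀ (G : (Fin k → ℝ) → ℝ), ContDiff ℝ 1 G →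
  ∀ (v₀ : ℕ → ℕ), (∀ N i, Int.gcd ((v₀ N : ℤ) + h i) (maynardW N) = 1) →
    (fun N : ℕ => maynardS1 k h ((maynardSimplex k).indicator G) (maynardR θ δ N) (maynardW N) (v₀ N) N
        - maynardMainTerm k θ δ N * maynardI k ((maynardSimplex k).indicator G))
      =o[atTop] maynardMainTerm k θ δ

/-- **Maynard 2015, Prop. 4.1, `S₂` part (= Lemma 6.3).** With the data of `maynard_S1_asymptotic`
and assuming the primes have level of distribution `θ > 0` in Maynard's sense (§1, p. 3;
`MaynardPrimesHaveLevel θ`), for each `m`,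
`S₂^{(m)} = φ(W)^k N (log R)^{k+1} / (W^{k+1} log N) · J_k^{(m)}(F) + o(φ(W)^k N (log R)^k / W^{k+1})`
as `N → ∞` (Lemma 6.3 gives the error `O(F_max² φ(W)^k N (log R)^k/(W^{k+1} D₀))`; summing over
`m` gives the `S₂` half of Prop. 4.1). A deep input (Maynard §5 Lemmas 5.2–5.3, using the level of
distribution for moduli `q ≤ R²W`, and §6 Lemmas 6.1, 6.3), vendored as a named fact.
[cite: MaynardAnnals2015, Prop. 4.1 and Lemma 6.3] -/
def maynard_S2_asymptotic : Prop :=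
  ∀ (k : ℕ) (h : Fin k → ℤ), Function.Injective h →
  ∀ (θ δ : ℝ), 0 < δ → 0 < θ / 2 - δ → MaynardPrimesHaveLevel θ →
  ∀ (G : (Fin k → ℝ) → ℝ), ContDiff ℝ 1 G →
  ∀ (v₀ : ℕ → ℕ), (∀ N i, Int.gcd ((v₀ N : ℤ) + h i) (maynardW N) = 1) →
  ∀ m : Fin k,
    (fun N : ℕ => maynardS2 k h ((maynardSimplex k).indicator G) (maynardR θ δ N) (maynardW N) (v₀ N) N m
        - maynardMainTerm k θ δ N * (Real.log (maynardR θ δ N) / Real.log N) *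
            maynardJ k m ((maynardSimplex k).indicator G))
      =o[atTop] maynardMainTerm k θ δ

/-- **Maynard 2015, Prop. 4.2 with the conclusion of Thm 3.1, for test functions `F = G · 1_{R_k}`,
`G ∈ C¹`** (the special case of `frequently_card_primes_ge_of_maynardFunctional`, which allows every
square-integrable `F`, to the class of `F` Maynard's Prop. 4.1 is stated for and to which it is applied
in §7: polynomials cut off to `R_k`): primes with level of distribution `θ > 0`
(`PrimesHaveLevel θ`), `H` admissible with `#H = k`, `F = G · 1_{R_k}` admissible with
`(∑ₘ J_k^{(m)}(F))/I_k(F) > 2m/θ` ⟹ for infinitely many `n`, at least `m + 1` of the `n + hᵢ` are prime.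
Proved below from `maynard_S1_asymptotic` and `maynard_S2_asymptotic`
(`frequently_card_primes_ge_of_maynardFunctional_smooth_of_asymptotics`); implied by the general fact
(`frequently_card_primes_ge_of_maynardFunctional_smooth_of_general`). [cite: MaynardAnnals2015, Prop. 4.2 and §4, proof of Prop. 4.2] -/
def frequently_card_primes_ge_of_maynardFunctional_smooth : Prop :=
  ∀ (θ : ℝ) (_hθ0 : 0 < θ) (_hθ : PrimesHaveLevel θ) (m k : ℕ) (G : (Fin k → ℝ) → ℝ)
    (_hG : ContDiff ℝ 1 G) (_hF : IsMaynardAdmissible k ((maynardSimplex k).indicator G))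
    (_hM : 2 * (m : ℝ) / θ < maynardFunctional k ((maynardSimplex k).indicator G))
    (H : Finset ℤ) (_hH : IsAdmissibleTuple H) (_hk : H.card = k),
    ∃ᶠ n : ℕ in atTop,
      m + 1 ≤ #(H.filter fun h ↦ 0 < (n : ℤ) + h ∧ ((n : ℤ) + h).toNat.Prime)

/-- The `C¹` case is a special case of the general (square-integrable) Prop. 4.2 fact of
`MaynardTao.lean`. [cite: MaynardAnnals2015, Prop. 4.2] -/
theorem frequently_card_primes_ge_of_maynardFunctional_smooth_of_general
    (h : frequently_card_primes_ge_of_maynardFunctional) :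
    frequently_card_primes_ge_of_maynardFunctional_smooth :=
  fun θ hθ0 hθ m k G _ hF hM H hH hk => h θ hθ0 hθ m k ((maynardSimplex k).indicator G) hF hM H hH hk


/-! ### From the tree's level of distribution to Maynard's (§1, p. 3) -/

/-- `PrimesHaveLevelPi θ` (level `x^{θ−ε}` for every `ε > 0`, with `max_{y ≤ x}`) gives Maynard's
level hypothesis (§1, p. 3) at every smaller exponent `θ₁ < θ` (take `ε = θ − θ₁` and `y = x`). [folklore] -/
theorem maynardPrimesHaveLevel_of_primesHaveLevelPi {θ θ₁ : ℝ} (h : PrimesHaveLevelPi θ)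
    (hθ₁ : θ₁ < θ) : MaynardPrimesHaveLevel θ₁ := by
  intro A hA
  have hε : 0 < θ - θ₁ := sub_pos.mpr hθ₁
  have h1 := h A hA (θ - θ₁) hε
  rw [show θ - (θ - θ₁) = θ₁ by ring] at h1
  refine IsBigO.trans (IsBigO.of_bound 1 ?_) h1
  filter_upwards [eventually_ge_atTop (1 : ℝ)] with x hx
  rw [one_mul, Real.norm_eq_abs, Real.norm_eq_abs]
  have hnn1 : 0 ≤ ∑ q ∈ Icc 1 ⌊x ^ θ₁⌋₊, ⨆ a : (ZMod q)ˣ,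
      |(LevelOfDistribution.primeCountingMod q (a : ZMod q).val ⌊x⌋₊ : ℝ) - (Nat.primeCounting ⌊x⌋₊ : ℝ) / Nat.totient q| :=
    Finset.sum_nonneg fun q _ => Real.iSup_nonneg fun a => abs_nonneg _
  have hnn2 : 0 ≤ ∑ q ∈ Icc 1 ⌊x ^ θ₁⌋₊, ⨆ y : Set.Icc 1 x, ⨆ a : (ZMod q)ˣ,
      |(LevelOfDistribution.primeCountingMod q (a : ZMod q).val ⌊(y : ℝ)⌋₊ : ℝ) -
        (Nat.primeCounting ⌊(y : ℝ)⌋₊ : ℝ) / Nat.totient q| :=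
    Finset.sum_nonneg fun q _ => Real.iSup_nonneg fun y => Real.iSup_nonneg fun a => abs_nonneg _
  rw [abs_of_nonneg hnn1, abs_of_nonneg hnn2]
  refine Finset.sum_le_sum fun q hq => ?_
  have hq0 : q ≠ 0 := Nat.one_le_iff_ne_zero.mp (Finset.mem_Icc.mp hq).1
  haveI : NeZero q := ⟨hq0⟩
  refine Real.iSup_le (fun a => ?_) (Real.iSup_nonneg fun y => Real.iSup_nonneg fun a => abs_nonneg _)
  have hfl1 : 1 ≤ ⌊x⌋₊ := Nat.le_floor (by simpa using hx)
  have hflx : ((⌊x⌋₊ : ℕ) : ℝ) ≤ x := Nat.floor_le (by linarith)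
  rw [primeCountingMod_sub_div_eq hq0]
  exact abs_primeCountingDisc_le_iSup hq0 a hfl1 hflx

/-- `PrimesHaveLevel θ` gives Maynard's level hypothesis (§1, p. 3) at every `θ₁ < θ`
(`PrimesHaveLevel.primesHaveLevelPi` and the previous lemma). In particular the
Bombieri–Vinogradov theorem gives it for every `θ < 1/2`, which is how it enters the proof of
Theorem 1.3. [folklore] -/
theorem maynardPrimesHaveLevel_of_primesHaveLevel {θ θ₁ : ℝ} (h : PrimesHaveLevel θ)
    (hθ₁ : θ₁ < θ) : MaynardPrimesHaveLevel θ₁ :=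
  maynardPrimesHaveLevel_of_primesHaveLevelPi h.primesHaveLevelPi hθ₁

/-! ### The choice of `v₀` (Chinese remainder theorem) -/

/-- For an admissible `H` and every prime `p` there is a residue `a (mod p)` with `p ∤ a + h` for
all `h ∈ H` (`a = −r` for a class `r` missed by `H`). [folklore] -/
theorem exists_forall_not_dvd_add_of_isAdmissibleTuple {H : Finset ℤ} (hH : IsAdmissibleTuple H)
    {p : ℕ} (hp : p.Prime) : ∃ a : ℕ, ∀ h ∈ H, ¬ ((p : ℤ) ∣ (a : ℤ) + h) := by
  haveI : NeZero p := ⟨hp.ne_zero⟩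
  have hlt := hH p hp
  obtain ⟨r, hr⟩ : ∃ r : ZMod p, r ∉ H.image (fun h : ℤ => (h : ZMod p)) := by
    by_contra hall
    push Not at hall
    have huniv : (H.image fun h : ℤ => (h : ZMod p)) = Finset.univ :=
      Finset.eq_univ_iff_forall.mpr hall
    unfold tupleResidueCount at hlt
    rw [huniv, Finset.card_univ, ZMod.card] at hlt
    exact lt_irrefl _ hlt
  refine ⟨(-r).val, fun h hh hdvd => hr ?_⟩
  rw [Finset.mem_image]
  refine ⟨h, hh, ?_⟩
  have h0 : (((((-r).val : ℕ) : ℤ) + h : ℤ) : ZMod p) = 0 :=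
    (ZMod.intCast_zmod_eq_zero_iff_dvd _ p).mpr hdvd
  push_cast at h0
  rw [ZMod.natCast_zmod_val] at h0
  exact (neg_add_eq_zero.mp h0).symm

/-- **The choice of `v₀` in Maynard 2015 §4**: "By the Chinese remainder theorem we can choose `v₀`
such that `v₀ + hᵢ` is coprime to `W` for each `i` since `H` is admissible" — for `W = ∏_{p ≤ D} p`.
[cite: MaynardAnnals2015, §4, first paragraph] -/
theorem exists_forall_gcd_add_primorial_eq_one {H : Finset ℤ} (hH : IsAdmissibleTuple H) (D : ℕ) :
    ∃ v : ℕ, ∀ h ∈ H, Int.gcd ((v : ℤ) + h) (primorial D) = 1 := by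
  classical
  have key := fun p (hp : Nat.Prime p) => exists_forall_not_dvd_add_of_isAdmissibleTuple hH hp
  choose a ha using key
  set a' : ℕ → ℕ := fun p => if hp : p.Prime then a p hp else 0 with ha'
  set t : Finset ℕ := (Finset.range (D + 1)).filter Nat.Prime with ht
  have hs : ∀ p ∈ t, (fun p : ℕ => p) p ≠ 0 := fun p hp => (Finset.mem_filter.mp hp).2.ne_zero
  have hpw : Set.Pairwise (↑t : Set ℕ) (Function.onFun Nat.Coprime fun p : ℕ => p) := by
    intro p hp q hq hne
    exact (Nat.coprime_primes (Finset.mem_filter.mp hp).2 (Finset.mem_filter.mp hq).2).mpr hne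
  obtain ⟨v, hv⟩ := Nat.chineseRemainderOfFinset a' (fun p => p) t hs hpw
  refine ⟨v, fun h hh => ?_⟩
  by_contra hne
  obtain ⟨p, hp, hpd⟩ := Nat.exists_prime_and_dvd hne
  have hpW : p ∣ primorial D := by
    have h1 : ((Int.gcd ((v : ℤ) + h) (primorial D) : ℕ) : ℤ) ∣ (primorial D : ℤ) :=
      Int.gcd_dvd_right _ _
    have h2 : (p : ℤ) ∣ (primorial D : ℤ) := (Int.natCast_dvd_natCast.mpr hpd).trans h1
    exact Int.natCast_dvd_natCast.mp h2
  have hpD : p ≤ D := hp.dvd_primorial_iff.mp hpW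
  have hpt : p ∈ t := Finset.mem_filter.mpr ⟨Finset.mem_range.mpr (Nat.lt_succ_of_le hpD), hp⟩
  have hva : v ≡ a' p [MOD p] := hv p hpt
  have hva' : a' p = a p hp := by rw [ha']; exact dif_pos hp
  have hdvd : (p : ℤ) ∣ (v : ℤ) + h :=
    (Int.natCast_dvd_natCast.mpr hpd).trans (Int.gcd_dvd_left _ _)
  haveI : NeZero p := ⟨hp.ne_zero⟩
  apply ha p hp h hh
  rw [← ZMod.intCast_zmod_eq_zero_iff_dvd] at hdvd ⊢
  push_cast at hdvd ⊢
  rw [(ZMod.natCast_eq_natCast_iff _ _ _).mpr (hva.trans (by rw [hva']))] at hdvd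
  exact hdvd

/-! ### Elementary facts about the main term and the sums -/

/-- For `N ≥ 2` and `θ/2 − δ > 0` the main term `φ(W)^k N (log R)^k / W^{k+1}` is positive. [folklore] -/
theorem maynardMainTerm_pos (k : ℕ) {θ δ : ℝ} (hη : 0 < θ / 2 - δ) {N : ℕ} (hN : 2 ≤ N) :
    0 < maynardMainTerm k θ δ N := by
  unfold maynardMainTerm maynardR
  have hW : 0 < (maynardW N : ℝ) := by exact_mod_cast primorial_pos _
  have hφ : 0 < (Nat.totient (maynardW N) : ℝ) := by
    exact_mod_cast Nat.totient_pos.mpr (primorial_pos _)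
  have hN' : (1 : ℝ) < N := by exact_mod_cast hN
  have hlog : 0 < Real.log ((N : ℝ) ^ (θ / 2 - δ)) := Real.log_pos (Real.one_lt_rpow hN' hη)
  positivity

/-- `log R / log N = θ/2 − δ` for `N ≥ 2`. [folklore] -/
theorem log_maynardR_div_log {θ δ : ℝ} {N : ℕ} (hN : 2 ≤ N) :
    Real.log (maynardR θ δ N) / Real.log N = θ / 2 - δ := by
  unfold maynardR
  have hN0 : (0 : ℝ) < N := by exact_mod_cast (show 0 < N by omega)
  have hN1 : (1 : ℝ) < N := by exact_mod_cast hN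
  rw [Real.log_rpow hN0, mul_div_assoc, div_self (Real.log_pos hN1).ne', mul_one]

/-- `S(N, ρ) = S₂ − ρ S₁ = ∑_n (∑ₘ χ_ℙ(n + hₘ) − ρ) w_n` (Maynard 2015 §2, the display defining
`S(N, ρ)`, p. 5, with the weights `w_n = (∑_{dᵢ∣n+hᵢ} λ_d)²` of §4). [cite: MaynardAnnals2015, §2, definition of S(N, ρ) (p. 5)] -/
theorem sum_maynardS2_sub_mul_maynardS1 (k : ℕ) (h : Fin k → ℤ) (F : (Fin k → ℝ) → ℝ) (R : ℝ)
    (W v₀ N : ℕ) (ρ : ℝ) :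
    ∑ m, maynardS2 k h F R W v₀ N m - ρ * maynardS1 k h F R W v₀ N =
      ∑ n ∈ (Finset.Ico N (2 * N)).filter (fun n => n ≡ v₀ [MOD W]),
        ((∑ m : Fin k, if 0 < (n : ℤ) + h m ∧ ((n : ℤ) + h m).toNat.Prime then (1 : ℝ) else 0) - ρ) *
          maynardDivisorSum k h F R W n ^ 2 := by
  unfold maynardS2 maynardS1
  rw [Finset.sum_comm, Finset.mul_sum, ← Finset.sum_sub_distrib]
  refine Finset.sum_congr rfl fun n _ => ?_
  rw [sub_mul, Finset.sum_mul]

/-- The pigeonhole step of Maynard 2015 §2: "If we can show that `S(N, ρ) > 0` then at least one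
term in the sum over `n` must have a positive contribution. By the non-negativity of `w_n`, this
means that there must be some integer `n ∈ [N, 2N]` such that at least `⌊ρ + 1⌋` of the `n + hᵢ`
are prime" (here `ρ = m`, so at least `m + 1`). [cite: MaynardAnnals2015, §2, paragraph after the definition of S(N, ρ) (p. 5)] -/
theorem exists_card_ge_of_sum_pos (k : ℕ) (h : Fin k → ℤ) (F : (Fin k → ℝ) → ℝ) (R : ℝ)
    (W v₀ N m : ℕ)
    (hpos : 0 < ∑ m', maynardS2 k h F R W v₀ N m' - (m : ℝ) * maynardS1 k h F R W v₀ N) :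
    ∃ n, N ≤ n ∧ m + 1 ≤ #(Finset.univ.filter fun i : Fin k =>
        0 < (n : ℤ) + h i ∧ ((n : ℤ) + h i).toNat.Prime) := by
  rw [sum_maynardS2_sub_mul_maynardS1] at hpos
  obtain ⟨n, hn, hterm⟩ : ∃ n ∈ (Finset.Ico N (2 * N)).filter (fun n => n ≡ v₀ [MOD W]),
      0 < ((∑ m' : Fin k, if 0 < (n : ℤ) + h m' ∧ ((n : ℤ) + h m').toNat.Prime then (1 : ℝ) else 0)
        - m) * maynardDivisorSum k h F R W n ^ 2 := by
    by_contra hall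
    push Not at hall
    exact absurd (Finset.sum_nonpos hall) (not_le.mpr hpos)
  refine ⟨n, (Finset.mem_Ico.mp (Finset.mem_filter.mp hn).1).1, ?_⟩
  rcases pos_and_pos_or_neg_and_neg_of_mul_pos hterm with ⟨h1, -⟩ | ⟨-, h2⟩
  · rw [Finset.sum_boole, sub_pos] at h1
    exact_mod_cast h1
  · exact absurd (sq_nonneg _) (not_le.mpr h2)

/-! ### Prop. 4.2 (with the conclusion of Thm 3.1) from Prop. 4.1 -/

/-- **Maynard 2015, proof of Prop. 4.2 (§4, p. 7) and of the "many primes" conclusion (§2)**, for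
test functions `F = G · 1_{R_k}`, `G ∈ C¹`: the asymptotics `maynard_S1_asymptotic` (Lemma 6.2) and
`maynard_S2_asymptotic` (Lemma 6.3) — i.e. Prop. 4.1 — imply
`frequently_card_primes_ge_of_maynardFunctional_smooth`. As printed: with `ρ = m`,
`S = S₂ − ρ S₁ = φ(W)^k N (log R)^k / W^{k+1} · ((log R/log N) ∑ₘ J_k^{(m)}(F) − ρ I_k(F) + o(1))`,
and `(θ₁/2 − δ) ∑ₘ J^{(m)} − m I > 0` once `θ₁ < θ` and `δ > 0` are close enough to `θ`, `0`
(possible exactly because `∑ₘ J^{(m)}/I > 2m/θ`); so `S > 0` for all large `N`, whence some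
`n ∈ [N, 2N)` has `> m` primes among the `n + hᵢ` (`exists_card_ge_of_sum_pos`). The level
hypothesis `PrimesHaveLevel θ` supplies Maynard's level hypothesis (§1, p. 3) at `θ₁`
(`maynardPrimesHaveLevel_of_primesHaveLevel`), and `v₀` comes from
`exists_forall_gcd_add_primorial_eq_one`. [cite: MaynardAnnals2015, Prop. 4.2 and its proof in §4] -/
theorem frequently_card_primes_ge_of_maynardFunctional_smooth_of_asymptotics
    (hS1 : maynard_S1_asymptotic) (hS2 : maynard_S2_asymptotic) :
    frequently_card_primes_ge_of_maynardFunctional_smooth := by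
  intro θ hθ0 hθ m k G hG hF hM H hH hk
  set F := (maynardSimplex k).indicator G with hFdef
  -- the numbers I, ∑J and the room in the hypothesis
  have hIpos : 0 < maynardI k F := hF.maynardI_pos
  set SJ := ∑ m', maynardJ k m' F with hSJdef
  have hSJnn : 0 ≤ SJ :=
    Finset.sum_nonneg fun m' _ => integral_nonneg fun t => sq_nonneg _
  have hMdef : maynardFunctional k F = SJ / maynardI k F := rfl
  rw [hMdef, lt_div_iff₀ hIpos] at hM
  -- hM : 2 * m / θ * I < SJ
  have hmnn : (0 : ℝ) ≤ m := Nat.cast_nonneg m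
  -- choose θ₁ ∈ (0, θ) with 2 m I < θ₁ SJ
  have hroom : 2 * (m : ℝ) * maynardI k F < θ * SJ := by
    rw [← div_lt_iff₀' hθ0]
    calc 2 * (m : ℝ) * maynardI k F / θ = 2 * m / θ * maynardI k F := by ring
      _ < SJ := hM
  obtain ⟨θ₁, hθ₁lo, hθ₁hi⟩ : ∃ θ₁ : ℝ, 2 * (m : ℝ) * maynardI k F < θ₁ * SJ ∧ θ₁ < θ := by
    have hSJpos : 0 < SJ := by
      rcases hSJnn.lt_or_eq with hpos | hzero
      · exact hpos
      · exfalso; rw [← hzero, mul_zero] at hroom; nlinarith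
    refine ⟨(2 * m * maynardI k F / SJ + θ) / 2, ?_, ?_⟩
    · rw [show (2 * (m : ℝ) * maynardI k F / SJ + θ) / 2 * SJ = (2 * m * maynardI k F + θ * SJ) / 2 by
        field_simp]
      linarith
    · have : 2 * (m : ℝ) * maynardI k F / SJ < θ := by rwa [div_lt_iff₀ hSJpos]
      linarith
  have hθ₁pos : 0 < θ₁ := by
    by_contra hle
    push Not at hle
    have : θ₁ * SJ ≤ 0 := mul_nonpos_of_nonpos_of_nonneg hle hSJnn
    nlinarith [mul_nonneg (mul_nonneg (by norm_num : (0:ℝ) ≤ 2) hmnn) hIpos.le]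
  -- Maynard's level at θ₁, and θ₁ ≤ 1
  have hlevel : MaynardPrimesHaveLevel θ₁ := maynardPrimesHaveLevel_of_primesHaveLevel hθ hθ₁hi
  have hθ₁le : θ₁ ≤ 1 := (hθ₁hi.le.trans (PrimesHaveLevel.le_one hθ))
  -- choose δ
  set gap := θ₁ / 2 * SJ - m * maynardI k F with hgapdef
  have hgap : 0 < gap := by rw [hgapdef]; linarith
  set δ := min (θ₁ / 4) (gap / (2 * (SJ + 1))) with hδdef
  have hδpos : 0 < δ := lt_min (by linarith) (by positivity)
  have hδle1 : δ ≤ θ₁ / 4 := min_le_left _ _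
  have hδle2 : δ ≤ gap / (2 * (SJ + 1)) := min_le_right _ _
  have hη : 0 < θ₁ / 2 - δ := by linarith
  set c := (θ₁ / 2 - δ) * SJ - m * maynardI k F with hcdef
  have hc : 0 < c := by
    have h1 : δ * SJ ≤ gap / (2 * (SJ + 1)) * SJ := mul_le_mul_of_nonneg_right hδle2 hSJnn
    have h2 : gap / (2 * (SJ + 1)) * SJ ≤ gap / 2 := by
      rw [div_mul_eq_mul_div, div_le_div_iff₀ (by positivity) (by positivity)]
      nlinarith
    have : c = gap - δ * SJ := by rw [hcdef, hgapdef]; ring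
    rw [this]
    linarith
  -- `k ≥ 1` (otherwise `∑ₘ J^{(m)} = 0` contradicts the hypothesis)
  have hk0 : 0 < k := by
    rcases Nat.eq_zero_or_pos k with hzero | hpos
    · exfalso
      subst hzero
      have hSJ0 : SJ = 0 := by rw [hSJdef]; exact Finset.sum_of_isEmpty _
      rw [hSJ0, mul_zero] at hroom
      nlinarith [mul_nonneg (mul_nonneg (by norm_num : (0:ℝ) ≤ 2) hmnn) hIpos.le]
    · exact hpos
  -- enumerate H
  set e := H.orderIsoOfFin hk with hedef
  set hf : Fin k → ℤ := fun j => ((e j : H) : ℤ) with hhf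
  have hinj : Function.Injective hf := fun i j hij =>
    e.injective (Subtype.val_injective hij)
  have hmemH : ∀ j, hf j ∈ H := fun j => (e j).2
  have himage : Finset.univ.image hf = H := by
    ext x
    simp only [Finset.mem_image, Finset.mem_univ, true_and]
    constructor
    · rintro ⟨j, rfl⟩; exact hmemH j
    · intro hx; exact ⟨e.symm ⟨x, hx⟩, by simp [hhf]⟩
  -- the residues v₀(N)
  have hv : ∀ N : ℕ, ∃ v : ℕ, ∀ x ∈ H, Int.gcd ((v : ℤ) + x) (primorial (maynardD0 N)) = 1 :=
    fun N => exists_forall_gcd_add_primorial_eq_one hH (maynardD0 N)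
  choose v₀ hv₀ using hv
  have hv₀' : ∀ N i, Int.gcd ((v₀ N : ℤ) + hf i) (maynardW N) = 1 := fun N i => hv₀ N (hf i) (hmemH i)
  -- the asymptotics
  have e1 := hS1 k hk0 hf hinj θ₁ δ hδpos hη hθ₁le G hG v₀ hv₀'
  have e2 := fun m' => hS2 k hf hinj θ₁ δ hδpos hη hlevel G hG v₀ hv₀' m'
  -- the combination S(N) - MT(N) * c is o(MT)
  set MT := maynardMainTerm k θ₁ δ with hMTdef
  set Sfun : ℕ → ℝ := fun N => ∑ m', maynardS2 k hf F (maynardR θ₁ δ N) (maynardW N) (v₀ N) N m'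
      - (m : ℝ) * maynardS1 k hf F (maynardR θ₁ δ N) (maynardW N) (v₀ N) N with hSfun
  have hlin : (fun N => Sfun N - MT N * ((Real.log (maynardR θ₁ δ N) / Real.log N) * SJ
      - m * maynardI k F)) =o[atTop] MT := by
    have hsum := IsLittleO.sum (s := Finset.univ) fun m' (_ : m' ∈ Finset.univ) => e2 m'
    have hcomb := hsum.sub (e1.const_mul_left (m : ℝ))
    refine hcomb.congr' (Eventually.of_forall fun N => ?_) EventuallyEq.rfl
    simp only [hSfun, hSJdef, Finset.sum_sub_distrib, ← Finset.mul_sum]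
    ring
  have hlin' : (fun N => Sfun N - MT N * c) =o[atTop] MT := by
    refine hlin.congr' ?_ EventuallyEq.rfl
    filter_upwards [eventually_ge_atTop 2] with N hN
    rw [log_maynardR_div_log hN]
  -- hence S(N) > 0 eventually
  have hSpos : ∀ᶠ N in atTop, 0 < Sfun N := by
    have hbd := hlin'.def (half_pos hc)
    filter_upwards [hbd, eventually_ge_atTop 2] with N hN hN2
    have hMTpos : 0 < MT N := maynardMainTerm_pos k hη hN2
    rw [Real.norm_eq_abs, Real.norm_eq_abs, abs_of_pos hMTpos] at hN
    have := (abs_le.mp hN).1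
    nlinarith
  -- and the conclusion
  rw [Filter.frequently_atTop]
  intro a
  obtain ⟨N₀, hN₀⟩ := eventually_atTop.mp hSpos
  obtain ⟨n, hn, hcard⟩ := exists_card_ge_of_sum_pos k hf F (maynardR θ₁ δ (max a N₀))
    (maynardW (max a N₀)) (v₀ (max a N₀)) (max a N₀) m (hN₀ _ (le_max_right _ _))
  refine ⟨n, (le_max_left _ _).trans hn, ?_⟩
  -- transport the count from `Fin k` to `H`
  have hcount : #(Finset.univ.filter fun i : Fin k => 0 < (n : ℤ) + hf i ∧ ((n : ℤ) + hf i).toNat.Prime)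
      = #(H.filter fun x ↦ 0 < (n : ℤ) + x ∧ ((n : ℤ) + x).toNat.Prime) := by
    rw [← himage, Finset.filter_image, Finset.card_image_of_injective _ hinj]
  rw [← hcount]
  exact hcard

end Literature.NumberTheory.Sieve
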